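import Mathlib
import HarnessLib
import Literature.Analysis.FluidPDE.ClassicalSolution
import Literature.Analysis.FluidPDE.Vorticity
import Summits.NavierStokesRegularity.NavierStokesRegularity.Theorems.QuarterLogPincerBeadCensusDefs
import Summits.NavierStokesRegularity.NavierStokesRegularity.Theorems.QuarterLogPincerBeadCensusKernel
import Summits.NavierStokesRegularity.NavierStokesRegularity.Theorems.QuarterLogPincerCubicRungDefs

/-!
# Route `QuarterLogPincer`, crux `TypeIQuantSubcubicExp` (stmt-NavierStokesRegularity-24077), line `flat_chain` —
# the line's OBJECTS, verbatim (Defs file), part 1: the epoch block and S3 `TypeIEpoch`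

VERBATIM port of statement objects of ns-idea-7 g14's workfile `Cruxes/TypeIQuantSubcubicExp/Lines/flat_chain.lean`
(LINE g14-1 `flat_chain` / g14-2 `slice_census` / g14-3 `quiet_seed`; text identical in v1 54e1ab8c9a00, v1.1 a2d620a29fc7 and
v1.2 789c9e87be36), in the namespace `…Cruxes.TypeIQuantSubcubicExp.FlatChain`: the data block `EpochBlock` (Tao's "epoch of
regularity" data (5.9)) and the registered stub statement S3 `TypeIEpoch` (epochs of regularity are free under the Type-I rate).
This first deposit carries exactly the objects S3 needs (their text does not involve the line's census / concentration
objects, which are still under the critic's reading); the remaining objects of the line (`ConcBlock`, G2♭ `BPChainRateFlat`,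
S1 `LevelConcentration`, S4 `GoodLevelTransfer`, §7 `RegularBlock` / S4′ `RegularBlockTransfer` / `SliceCensus` / β
`LightSliceRegular`, §9 Q3 `QuietSliceSmallCube`) are appended to this file once their text is stamped.  Docstrings as in
the workfile.  No stub is proved here.  HONEST FRAME: Props about HYPOTHETICAL Type-I classical solutions; nothing here bears on
24077's truth, W7 or Navier–Stokes regularity (OPEN / not proved).  pub-ns-dss typer (g39), `--supports
stmt-NavierStokesRegularity-24077`; text by ns-idea-7 (g14).
-/

set_option linter.dupNamespace false

noncomputable section

open MeasureTheory Set Metric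
open scoped ENNReal NNReal
open Literature.Analysis Literature.Analysis.FluidPDE

namespace Summit.NavierStokesRegularity.NavierStokesRegularity.Cruxes.TypeIQuantSubcubicExp.FlatChain

/-! ## The epoch block (data exchanged between the stubs S3 and S4/S4′) -/

/-- **Epoch block** at scale `s` and depth divisor `D`: on the time block `[t₁ − 4s/D, t₁ − s/D]` (depths between
`s/D` and `4s/D` below `t₁`) the solution obeys GLOBAL `C¹` bounds for `u` and `ω = curl u` at the parabolic scale
`s/D`, with constant `Ce`.  (Tao's "epoch of regularity" data (5.9) for (5.7).) -/
def EpochBlock (Ce D : ℝ) (u : ℝ → EuclideanSpace ℝ (Fin 3) → EuclideanSpace ℝ (Fin 3)) (t₁ s : ℝ) : Prop :=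
  ∀ t ∈ Icc (t₁ - 4 * (s / D)) (t₁ - s / D), ∀ x : EuclideanSpace ℝ (Fin 3),
    ‖u t x‖ ≤ Ce * (s / D) ^ (-(1 / 2 : ℝ)) ∧ ‖fderiv ℝ (u t) x‖ ≤ Ce * (s / D)⁻¹ ∧
      ‖vorticity u t x‖ ≤ Ce * (s / D)⁻¹ ∧ ‖fderiv ℝ (vorticity u t) x‖ ≤ Ce * (s / D) ^ (-(3 / 2 : ℝ))

/-! ## Obligation Prop S3 -/

/-- **S3 `TypeIEpoch`** — epochs of regularity are free under the Type-I rate: for `0 < s ≤ t₁ ≤ T` and `D ≥ 8` the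
block `[t₁ − 4s/D, t₁ − s/D]` carries global bounds `|u| ≤ Ce(s/D)^{-1/2}`, `‖∇u‖, |ω| ≤ Ce(s/D)^{-1}`,
`‖∇ω‖ ≤ Ce(s/D)^{-3/2}` (`Ce = Ce(M)`), by Type-I (`T+τ−t ≥ s/D` there) and bounded-mild smoothing from the run-up
`[t₁ − 8s/D, t₁ − 4s/D] ⊂ [0,T]`.  [KNSS2009 / tree `knss2009_smoothing_of_local`; Tao2021 (5.9)]  Size M. -/
def TypeIEpoch : Prop :=
  ∀ M : ℝ, ∃ Ce : ℝ, 1 ≤ Ce ∧ ∀ D : ℝ, 8 ≤ D →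
    ∀ (T τ t₁ s : ℝ) (u : ℝ → EuclideanSpace ℝ (Fin 3) → EuclideanSpace ℝ (Fin 3))
      (p : ℝ → EuclideanSpace ℝ (Fin 3) → ℝ),
      (IsClassicalNSSolutionOn (Icc 0 T) 1 0 u p ∧
        ∀ m : ℕ, ∃ C : NNReal, ∀ t ∈ Icc 0 T, eLpNorm (iteratedFDeriv ℝ m (u t)) 2 volume ≤ C) →
      0 < τ →
      (∀ t ∈ Icc 0 T, ∀ x : EuclideanSpace ℝ (Fin 3), ‖u t x‖ ≤ M * (T + τ - t) ^ (-(1 / 2 : ℝ))) →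
      t₁ ∈ Ioc 0 T → 0 < s → s ≤ t₁ → EpochBlock Ce D u t₁ s

end Summit.NavierStokesRegularity.NavierStokesRegularity.Cruxes.TypeIQuantSubcubicExp.FlatChain

end

/-!
## Part 2 (appended 2026-08-29, typer g39): the remaining statement objects of LINE `flat_chain`, verbatim

VERBATIM port of the remaining statement objects of `Cruxes/TypeIQuantSubcubicExp/Lines/flat_chain.lean` (text byte-identical
in v1.2 789c9e87be36 … v1.6; idea-crit-4 verdicts of record: flat_chain PASS A−, slice_census PASS B+; director dss_165 (2)):
G2♭ `BPChainRateFlat` with its two sorry-free edges (`bpChainRateFlat_of_bpChainRate`,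
`typeIQuantCubicExp_of_beadCensus_of_bpChainRateFlat` — the R0-rate rung `CubicRung.TypeIQuantCubicExp` BY NAME), the
concentration block `ConcBlock`, the obligation Props S2 `LocalSmoothingL6` (retired from the stubs, kept as the alternative
large-data route), S1 `LevelConcentration`, S4 `GoodLevelTransfer`, §7 `RegularBlock` (+ `goodLevel_iff_regularBlock`,
`RegularBlock.mono`), S4′ `RegularBlockTransfer` (+ `goodLevelTransfer_of_regularBlockTransfer`), `sliceTime`, `LightBlock`,
`HeavySlice`, `SliceCensusAt`, `SliceCensus`, β `LightSliceRegular`, and the kernel's per-level deposit Prop `GoodDepositAt`.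
Only textual change: the unused binder `hΛ'` of `RegularBlock.mono` is spelled `_hΛ'` (the tree builds with 0 warnings).
NOT homed here: Q3 `QuietSliceSmallCube` (the author's port annex `Lines/quiet_seed_port_QuietSliceSmallCube.lean` carries
def + proof for `Theorems/QuarterLogPincerQuietSliceSmallCube.lean`) and the v1.6 §10 plumbing objects (`sliceField`,
`LocalEnergySlice`; unstamped).  No stub is proved here.  HONEST FRAME as in part 1.
-/

noncomputable section

namespace Summit.NavierStokesRegularity.NavierStokesRegularity.Cruxes.TypeIQuantSubcubicExp.FlatChain

open MeasureTheory Set Metric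
open scoped ENNReal NNReal Classical
open Literature.Analysis Literature.Analysis.FluidPDE
open Summit.NavierStokesRegularity.NavierStokesRegularity.Cruxes.TypeIQuantSubcubicExp.BeadCensus
open Summit.NavierStokesRegularity.NavierStokesRegularity.Cruxes.TypeIQuantSubcubicExp.CubicRung

/-! ### G2♭ — the flattened chain statement and the re-proved rung edge -/

/-- **G2♭ `BPChainRateFlat`** (weaker than G2 `BeadCensus.BPChainRate`): for every large `M` there are an annulus
exponent `μ = μ(M) > 0`, a seed loss `b ≥ 0` and a level-separation threshold `a₁`, and for every `a ≥ a₁` a deposit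
`c = c(M, a) > 0`, such that `ChainAt M μ a b c`: under a violator of size `e^{a(n+1)}A^{b}` at most `A³/c` of the
first `n` levels are good.  [BarkerPrange2021 §3 (chain of Carleman inequalities), re-typed in the sup-rate gauge;
Tao2021QuantitativeNS §5] -/
def BPChainRateFlat : Prop :=
  ∃ M₀ : ℝ, 1 ≤ M₀ ∧ ∀ M : ℝ, M₀ ≤ M → ∃ μ b a₁ : ℝ, 0 < μ ∧ 0 ≤ b ∧ 0 < a₁ ∧
    ∀ a : ℝ, a₁ ≤ a → ∃ c : ℝ, 0 < c ∧ ChainAt M μ a b c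

/-- G2 ⇒ G2♭ (the flat form is weaker: `μ`, `c` may depend on `M`, resp. `a`). -/
theorem bpChainRateFlat_of_bpChainRate (h : BPChainRate) : BPChainRateFlat := by
  obtain ⟨μ, M₀, b, hμ, hM₀, hb, h⟩ := h
  refine ⟨M₀, hM₀, fun M hM => ?_⟩
  obtain ⟨a₁, c, ha₁, hc, hch⟩ := h M hM
  exact ⟨μ, b, a₁, hμ, hb, ha₁, fun a ha => ⟨c, hc, hch a ha⟩⟩

/-- **The rung edge survives the flattening (kernel-checked):** `BeadCensus → BPChainRateFlat → TypeIQuantCubicExp`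
(R0-rate, decl of record), by `quantCubicExpAt_of_censusAt_of_chainAt` at `M' := max M M₀`, `a := max a₀ a₁`. -/
theorem typeIQuantCubicExp_of_beadCensus_of_bpChainRateFlat (hcensus : BeadCensus)
    (hchain : BPChainRateFlat) : TypeIQuantCubicExp := by
  obtain ⟨M₀, hM₀, hlarge⟩ := hchain
  intro M
  have hM' : M₀ ≤ max M M₀ := le_max_right _ _
  have h1 : 1 ≤ max M M₀ := hM₀.trans hM'
  obtain ⟨μ, b, a₁, hμ, hb, ha₁, hch⟩ := hlarge (max M M₀) hM'
  obtain ⟨a₀, hcen⟩ := hcensus μ (max M M₀) hμ h1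
  obtain ⟨c, hc, hchain⟩ := hch (max a₀ a₁) (le_max_right _ _)
  exact quantCubicExpAt_antitone (le_max_left M M₀)
    (quantCubicExpAt_of_censusAt_of_chainAt (ha₁.trans_le (le_max_right _ _)) hb hc hchain
      (hcen _ (le_max_left _ _)))

/-! ### The concentration block -/

/-- **Concentration block** at scale `s`, depth divisor `D`, centre `x₀`: at every time of the block
`[t₁ − 4s/D, t₁ − s/D]` the enstrophy in `B(x₀, ρ√(s/D))` is at least `η (s/D)^{-1/2}`.  (BP21 Lemma 4's conclusion,
rate-gauge normalisation.) -/
def ConcBlock (ρ η D : ℝ) (u : ℝ → EuclideanSpace ℝ (Fin 3) → EuclideanSpace ℝ (Fin 3)) (t₁ : ℝ)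
    (x₀ : EuclideanSpace ℝ (Fin 3)) (s : ℝ) : Prop :=
  ∀ t ∈ Icc (t₁ - 4 * (s / D)) (t₁ - s / D),
    η * (s / D) ^ (-(1 / 2 : ℝ)) ≤ ∫ x in ball x₀ (ρ * Real.sqrt (s / D)), ‖vorticity u t x‖ ^ 2

/-! ### Obligation Props S2 (retired), S1, S4 -/

/-- **S2 `LocalSmoothingL6`** — local-in-space short-time smoothing for locally-`L⁶` data, physical variables, over the
classical frame: if `sup_x r⁻¹∫_{B(x,r)}|u(t₀)|² ≤ Mt²` and `r³∫_{B(x₀,2r)}|u(t₀)|⁶ ≤ N⁶`, then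
`|u| ≤ K(Mt,N)/r` on `B(x₀,r/2) × [t₀ + ¾Sr², t₀ + Sr²]`, `S = S(Mt,N) ∈ (0,1)`.
[JiaSverak2014 Thm 3.1 (subcritical local data, m = 6); BarkerPrange2021 (arXiv:2003.06717) Thm 3 p. 26 with
`S_* = O(1)Mt^{-30}N^{-70}`, `K = C_*Mt⁸N^{19}` (Remark 11)]  Size XL (literature port; constants existential). -/
def LocalSmoothingL6 : Prop :=
  ∀ Mt N : ℝ, 1 ≤ Mt → 1 ≤ N → ∃ S K : ℝ, 0 < S ∧ S < 1 ∧ 0 < K ∧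
    ∀ (t₀ r : ℝ) (x₀ : EuclideanSpace ℝ (Fin 3))
      (u : ℝ → EuclideanSpace ℝ (Fin 3) → EuclideanSpace ℝ (Fin 3)) (p : ℝ → EuclideanSpace ℝ (Fin 3) → ℝ),
      0 < r →
      (IsClassicalNSSolutionOn (Icc t₀ (t₀ + S * r ^ 2)) 1 0 u p ∧
        ∀ m : ℕ, ∃ C : NNReal, ∀ t ∈ Icc t₀ (t₀ + S * r ^ 2),
          eLpNorm (iteratedFDeriv ℝ m (u t)) 2 volume ≤ C) →
      (∀ x : EuclideanSpace ℝ (Fin 3),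
        ∫⁻ y in ball x r, ENNReal.ofReal (‖u t₀ y‖ ^ 2) ≤ ENNReal.ofReal (Mt ^ 2 * r)) →
      ∫⁻ y in ball x₀ (2 * r), ENNReal.ofReal (‖u t₀ y‖ ^ 6) ≤ ENNReal.ofReal (N ^ 6 / r ^ 3) →
      ∀ t ∈ Icc (t₀ + 3 / 4 * (S * r ^ 2)) (t₀ + S * r ^ 2), ∀ x ∈ ball x₀ (r / 2), ‖u t x‖ ≤ K / r

/-- **S1 `LevelConcentration`** (BP21 Lemma 4 in the sup-rate gauge, seed loss `b = 0`): for a Type-I(M) classical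
solution, a point with `e^{a(n+1)} ≤ |u(t₁,x₀)|√t₁` forces, at EVERY level `k < n`, the concentration block
`ConcBlock ρ(M) η(M) D u t₁ x₀ s_{k+1}` (`s_{k+1} = t₁e^{-2a(k+1)}`), for every depth divisor `D ≥ 8` once
`a ≥ a₁(M, D)`.  Mechanism: else I1 (`ThinCascade.stub_uniformScaledEnergy`, uloc `≤ C(M)` at all radii `r² ≤ t₁`) +
interior elliptic estimate + Sobolev give `‖U(0)‖_{L⁶(B₂)} ≤ N(M)` after rescaling by `r = (σ/(⅞S))^{1/2}`, and S2
yields `|u(t₁,x₀)| ≤ K(M)(S/σ)^{1/2} ≤ K'√D·e^{a(k+1)}/√t₁ < e^{a(n+1)}/√t₁`.  No `A`, no Littlewood–Paley.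
[BarkerPrange2021 Lemma 4 p. 12 (weak-L³ gauge); this gauge: new]  Size M–L. -/
def LevelConcentration : Prop :=
  ∀ M : ℝ, ∃ ρ η : ℝ, 0 < ρ ∧ 0 < η ∧ ∀ D : ℝ, 8 ≤ D → ∃ a₁ : ℝ, 0 < a₁ ∧ ∀ a : ℝ, a₁ ≤ a →
    ∀ (T τ t₁ : ℝ) (x₀ : EuclideanSpace ℝ (Fin 3))
      (u : ℝ → EuclideanSpace ℝ (Fin 3) → EuclideanSpace ℝ (Fin 3)) (p : ℝ → EuclideanSpace ℝ (Fin 3) → ℝ)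
      (n : ℕ),
      (IsClassicalNSSolutionOn (Icc 0 T) 1 0 u p ∧
        ∀ m : ℕ, ∃ C : NNReal, ∀ t ∈ Icc 0 T, eLpNorm (iteratedFDeriv ℝ m (u t)) 2 volume ≤ C) →
      0 < τ →
      (∀ t ∈ Icc 0 T, ∀ x : EuclideanSpace ℝ (Fin 3), ‖u t x‖ ≤ M * (T + τ - t) ^ (-(1 / 2 : ℝ))) →
      t₁ ∈ Ioc 0 T → Real.exp (a * (n + 1)) ≤ ‖u t₁ x₀‖ * Real.sqrt t₁ →
      ∀ k : ℕ, k < n → ConcBlock ρ η D u t₁ x₀ (levelScale a t₁ (k + 1))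

/-- **S4 `GoodLevelTransfer`** — the deposit at a good level (Tao (5.7)ᵘ → (5.17) → (5.18), tree theorems
`vorticity_gaussian_lower_bound_uniform`, `IsClassicalNSSolutionOn.vorticity_annulus_lower_bound`,
`IsClassicalNSSolutionOn.velocity_cube_mass_of_vorticity_mass`): given the constants `(M, Ce, ρ, η)` there are a ratio
threshold `Λ₁` and a depth divisor `D` such that, whenever `M^{10μ} ≥ Λ₁` and `a ≥ 0`, a good level `k+1` whose block
carries `EpochBlock Ce D` and `ConcBlock ρ η D` deposits `c(M,Ce,ρ,η,μ,a) > 0` of cube mass at time `t₁` into its shell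
`levelShell M a t₁ x₀ (k+1)`.  The constant is honest in `a`: `c ≳ exp(−C e^{2a})` from the annulus Carleman factor
`exp(−KΛ²R²/T₅)`, `ΛR ≤ e^{a}√s`, `T₅ = s/32`.  [Tao2021QuantitativeNS §5 pp. 37–41]  Size L (transfer + constants,
translation `x₀ ↦ 0`, `|ω| ≤ √6‖∇u‖`). -/
def GoodLevelTransfer : Prop :=
  ∀ M Ce ρ η : ℝ, 1 ≤ M → 1 ≤ Ce → 0 < ρ → 0 < η → ∃ Λ₁ D : ℝ, 1 ≤ Λ₁ ∧ 8 ≤ D ∧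
    ∀ μ a : ℝ, 0 < μ → Λ₁ ≤ M ^ (10 * μ) → 0 ≤ a → ∃ c : ℝ, 0 < c ∧
      ∀ (T t₁ : ℝ) (x₀ : EuclideanSpace ℝ (Fin 3))
        (u : ℝ → EuclideanSpace ℝ (Fin 3) → EuclideanSpace ℝ (Fin 3)) (p : ℝ → EuclideanSpace ℝ (Fin 3) → ℝ)
        (k : ℕ),
        (IsClassicalNSSolutionOn (Icc 0 T) 1 0 u p ∧
          ∀ m : ℕ, ∃ C : NNReal, ∀ t ∈ Icc 0 T, eLpNorm (iteratedFDeriv ℝ m (u t)) 2 volume ≤ C) →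
        t₁ ∈ Ioc 0 T → GoodLevel M μ a u t₁ x₀ (k + 1) →
        EpochBlock Ce D u t₁ (levelScale a t₁ (k + 1)) →
        ConcBlock ρ η D u t₁ x₀ (levelScale a t₁ (k + 1)) →
        ENNReal.ofReal c ≤ ∫⁻ x in levelShell M a t₁ x₀ (k + 1), ‖u t₁ x‖ₑ ^ (3 : ℝ)

/-! ### §7 — regular blocks, S4′, the slice census, light-slice smoothing -/

/-- **Regular block** of ratio `Λ` and constant `Cg` at level `k` (bounded-regular annulus on the level window):
`GoodLevel` with `(M^{-3μ}, M^{10μ}) ↦ (Cg, Λ)`.  This is all S4's Tao transfer consumes (`T₅ := s/(C·Cg²)` is free). -/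
def RegularBlock (Cg Λ M a : ℝ) (u : ℝ → EuclideanSpace ℝ (Fin 3) → EuclideanSpace ℝ (Fin 3)) (t₁ : ℝ)
    (x₀ : EuclideanSpace ℝ (Fin 3)) (k : ℕ) : Prop :=
  ∃ R : ℝ, 4 * M * Real.sqrt (levelScale a t₁ k) ≤ R ∧
    Λ * R ≤ Real.exp a * Real.sqrt (levelScale a t₁ k) ∧
    ∀ t ∈ Icc (t₁ - levelScale a t₁ k / 32) t₁, ∀ x : EuclideanSpace ℝ (Fin 3),
      R < ‖x - x₀‖ → ‖x - x₀‖ < Λ * R →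
      ∀ j : ℕ, j ≤ 2 →
        ‖iteratedFDeriv ℝ j (u t) x‖ ≤ Cg * (levelScale a t₁ k) ^ (-(((j : ℝ) + 1) / 2))

/-- `GoodLevel` IS a regular block with the Barker–Prange pair of constants — definitionally. -/
theorem goodLevel_iff_regularBlock {M μ a : ℝ} {u : ℝ → EuclideanSpace ℝ (Fin 3) → EuclideanSpace ℝ (Fin 3)}
    {t₁ : ℝ} {x₀ : EuclideanSpace ℝ (Fin 3)} {k : ℕ} :
    GoodLevel M μ a u t₁ x₀ k ↔ RegularBlock (M ^ (-(3 * μ))) (M ^ (10 * μ)) M a u t₁ x₀ k :=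
  Iff.rfl

/-- Monotonicity of regular blocks: a larger constant and a smaller ratio are weaker demands (same inner radius). -/
theorem RegularBlock.mono {Cg Cg' Λ Λ' M a : ℝ} {u : ℝ → EuclideanSpace ℝ (Fin 3) → EuclideanSpace ℝ (Fin 3)}
    {t₁ : ℝ} {x₀ : EuclideanSpace ℝ (Fin 3)} {k : ℕ}
    (hM : 0 ≤ M) (ht₁ : 0 < t₁) (hC : Cg ≤ Cg') (_hΛ' : 0 ≤ Λ') (hΛ : Λ' ≤ Λ)
    (h : RegularBlock Cg Λ M a u t₁ x₀ k) : RegularBlock Cg' Λ' M a u t₁ x₀ k := by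
  obtain ⟨R, hR, hΛR, hreg⟩ := h
  have hs : 0 < levelScale a t₁ k := by unfold levelScale; positivity
  have hR0 : 0 ≤ R := le_trans (by positivity) hR
  refine ⟨R, hR, (mul_le_mul_of_nonneg_right hΛ hR0).trans hΛR, fun t ht x hx1 hx2 j hj => ?_⟩
  have hx2' : ‖x - x₀‖ < Λ * R := lt_of_lt_of_le hx2 (mul_le_mul_of_nonneg_right hΛ hR0)
  exact (hreg t ht x hx1 hx2' j hj).trans (mul_le_mul_of_nonneg_right hC (Real.rpow_nonneg hs.le _))

/-- **S4′ = `RegularBlockTransfer`** — S4 with a regular block `(Cg, Λ₁)` in place of a good level: for every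
`M, Ce, ρ, η, Cg` a ratio threshold `Λ₁` and a depth divisor `D` such that for `a ≥ 0` a level whose shell contains a
regular block of ratio `Λ₁` and whose block carries `EpochBlock Ce D` and `ConcBlock ρ η D` deposits `c(M,…,Cg,a) > 0` of
cube mass at `t₁` into `levelShell`.  Same three tree theorems as S4 ((5.7)ᵘ, (5.17), (5.18) BY NAME) with
`T₅ := s/(32·6·Cg²)` instead of `s/32`.  [Tao2021QuantitativeNS §5 pp. 37–41]  Size L. -/
def RegularBlockTransfer : Prop :=
  ∀ M Ce ρ η Cg : ℝ, 1 ≤ M → 1 ≤ Ce → 0 < ρ → 0 < η → 1 ≤ Cg → ∃ Λ₁ D : ℝ, 1 ≤ Λ₁ ∧ 8 ≤ D ∧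
    ∀ a : ℝ, 0 ≤ a → ∃ c : ℝ, 0 < c ∧
      ∀ (T t₁ : ℝ) (x₀ : EuclideanSpace ℝ (Fin 3))
        (u : ℝ → EuclideanSpace ℝ (Fin 3) → EuclideanSpace ℝ (Fin 3)) (p : ℝ → EuclideanSpace ℝ (Fin 3) → ℝ)
        (k : ℕ),
        (IsClassicalNSSolutionOn (Icc 0 T) 1 0 u p ∧
          ∀ m : ℕ, ∃ C : NNReal, ∀ t ∈ Icc 0 T, eLpNorm (iteratedFDeriv ℝ m (u t)) 2 volume ≤ C) →
        t₁ ∈ Ioc 0 T → RegularBlock Cg Λ₁ M a u t₁ x₀ (k + 1) →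
        EpochBlock Ce D u t₁ (levelScale a t₁ (k + 1)) →
        ConcBlock ρ η D u t₁ x₀ (levelScale a t₁ (k + 1)) →
        ENNReal.ofReal c ≤ ∫⁻ x in levelShell M a t₁ x₀ (k + 1), ‖u t₁ x‖ₑ ^ (3 : ℝ)

/-- **S4′ ⇒ S4**: a good level is a regular block with `Cg = 1 ≥ M^{-3μ}` and ratio `M^{10μ} ≥ Λ₁`. -/
theorem goodLevelTransfer_of_regularBlockTransfer (h : RegularBlockTransfer) : GoodLevelTransfer := by
  intro M Ce ρ η hM hCe hρ hη
  obtain ⟨Λ₁, D, hΛ₁, hD, H⟩ := h M Ce ρ η 1 hM hCe hρ hη le_rfl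
  refine ⟨Λ₁, D, hΛ₁, hD, fun μ a hμ hΛμ ha => ?_⟩
  obtain ⟨c, hc, Hc⟩ := H a ha
  refine ⟨c, hc, fun T t₁ x₀ u p k hframe ht₁ hgood hE hC => Hc T t₁ x₀ u p k hframe ht₁ ?_ hE hC⟩
  have hM0 : (0 : ℝ) ≤ M := by linarith
  have hpow : M ^ (-(3 * μ)) ≤ (1 : ℝ) := Real.rpow_le_one_of_one_le_of_nonpos hM (by linarith)
  exact (goodLevel_iff_regularBlock.1 hgood).mono hM0 ht₁.1 hpow (by linarith) hΛμ

/-- The slab-initial ("slice") time of level `k`: two level-times before `t₁`. -/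
def sliceTime (a t₁ : ℝ) (k : ℕ) : ℝ := t₁ - 2 * levelScale a t₁ k

/-- **Light block.** The block `{ρ√s_k ≤ ‖x−x₀‖ ≤ Λρ√s_k}` of level `k` is `γ`-LIGHT at test radius `ϑ√s_k`: every
test ball centred in it carries `≤ γ³` of cube mass at the slice time `t₁ − 2s_k` (ONE instant; nothing about the
window). -/
def LightBlock (γ ϑ Λ a : ℝ) (u : ℝ → EuclideanSpace ℝ (Fin 3) → EuclideanSpace ℝ (Fin 3)) (t₁ : ℝ)
    (x₀ : EuclideanSpace ℝ (Fin 3)) (k : ℕ) (ρ : ℝ) : Prop :=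
  ∀ x : EuclideanSpace ℝ (Fin 3), ρ * Real.sqrt (levelScale a t₁ k) ≤ ‖x - x₀‖ →
    ‖x - x₀‖ ≤ Λ * ρ * Real.sqrt (levelScale a t₁ k) →
    ∫⁻ y in ball x (ϑ * Real.sqrt (levelScale a t₁ k)), ‖u (sliceTime a t₁ k) y‖ₑ ^ (3 : ℝ) ≤
      ENNReal.ofReal (γ ^ 3)

/-- **Heavy slice.** Level `k` is HEAVY: NO admissible block (`ρ ≥ 4M`, `ρ ≥ ϑ`, `4Λρ ≤ e^{a}`) of ratio `4Λ` in its
slab is `γ`-light at the slice time — every admissible block holds a `γ`-heavy test ball. -/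
def HeavySlice (M γ ϑ Λ a : ℝ) (u : ℝ → EuclideanSpace ℝ (Fin 3) → EuclideanSpace ℝ (Fin 3)) (t₁ : ℝ)
    (x₀ : EuclideanSpace ℝ (Fin 3)) (k : ℕ) : Prop :=
  ∀ ρ : ℝ, 4 * M ≤ ρ → ϑ ≤ ρ → 4 * Λ * ρ ≤ Real.exp a → ¬ LightBlock γ ϑ (4 * Λ) a u t₁ x₀ k ρ

/-- `SliceCensusAt M γ ϑ Λ a C`: under a violator of `n` levels about `(t₁,x₀)`, at most `C·A³` of the levels `1..n`
are heavy slices. -/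
def SliceCensusAt (M γ ϑ Λ a C : ℝ) : Prop :=
  ∀ (T τ A t₁ : ℝ) (x₀ : EuclideanSpace ℝ (Fin 3))
    (u : ℝ → EuclideanSpace ℝ (Fin 3) → EuclideanSpace ℝ (Fin 3)) (p : ℝ → EuclideanSpace ℝ (Fin 3) → ℝ) (n : ℕ),
    (IsClassicalNSSolutionOn (Icc 0 T) 1 0 u p ∧
        ∀ m : ℕ, ∃ C : NNReal, ∀ t ∈ Icc 0 T, eLpNorm (iteratedFDeriv ℝ m (u t)) 2 volume ≤ C) →
      0 < τ →
      (∀ t ∈ Icc 0 T, ∀ x : EuclideanSpace ℝ (Fin 3), ‖u t x‖ ≤ M * (T + τ - t) ^ (-(1 / 2 : ℝ))) →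
      (∀ t ∈ Icc 0 T, eLpNorm (u t) 3 volume ≤ ENNReal.ofReal A) → 2 ≤ A →
      t₁ ∈ Ioc 0 T → Real.exp (a * (n + 1)) ≤ ‖u t₁ x₀‖ * Real.sqrt t₁ →
      (((Finset.range n).filter fun k => HeavySlice M γ ϑ Λ a u t₁ x₀ (k + 1)).card : ℝ) ≤ C * A ^ 3

/-- **`SliceCensus` — the RE-ROUTED CENSUS NODE (OPEN; the residual of LINE g14-2).**  For every Type-I constant,
lightness threshold `γ`, test-radius factor `ϑ` and block ratio `Λ`, beyond some level separation every `a` has a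
census constant: heavy slices `≤ C(M,γ,ϑ,Λ,a)·A³`.  A multi-time statement along the backward parabolic cone
(slice `k` is read at ITS time `t₁ − 2s_k` on ITS slab); no persistence to `t₁` is claimed.  DSS-saturated
(BP21 Thm 1 + Cor. 1: `‖u(t)‖³_{L³(B)} ≳ log(1/(T*−t))` is optimal).  Why it might fail: a converging front that is
`γ`-heavy log-uniformly across its slab at each slice time and burns out almost completely between consecutive slice
times (incoherent near-critical debris regenerated from the core), keeping `sup_t ‖u(t)‖₃` bounded while `n → ∞`.
PROOF OBLIGATION IS CROSS-TIME (critic N3, 12:49Z — recorded so that nobody files this node later as «persistence-free»):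
level `k` is read at `t₁ − 2s_k`, level `j < k` at `t₁ − 2s_j`, while the budget `A³ = sup_t ‖u(t)‖₃³` is per instant; any proof
must therefore buy SIMULTANEITY — heaviness of whole slabs co-existing / persisting across ≤ 2 own turnovers — i.e. exactly
Barker's missing local pigeonhole (arXiv:2209.15627 p.4) in census form; the gain over G1♯ `FlarePersistence` is the rarer
failure mode (one instant per level two level-times before `t₁`; ALL admissible blocks of the slab heavy), not freedom from
persistence.  Toy design row (no kit implied): count heavy slices vs `sup_t ‖u(t)‖₃³` along (i) a DSS-type Type-I profile,
(ii) a burning-front caricature. -/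
def SliceCensus : Prop :=
  ∀ M γ ϑ Λ : ℝ, 1 ≤ M → 0 < γ → 1 ≤ ϑ → 1 ≤ Λ →
    ∃ a₀ : ℝ, ∀ a : ℝ, a₀ ≤ a → ∃ C : ℝ, SliceCensusAt M γ ϑ Λ a C

/-- **β = `LightSliceRegular`** — a light block at the slice time becomes a regular block on the level window.  For
every `M ≥ 1` constants `Cg, γ, ϑ, a₂` (all functions of `M` only: `ϑ = √(8/S(M̃))`, `γ` = the Barker–Prange smallness,
`M̃² = C_I(M)` the I1 constant, `Cg` from the BP/KMT bounds and the bounded-solution bootstrap) such that for every ratio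
`Λ ≥ 1` and `a ≥ a₂`: an admissible light block `[ρ√s, 4Λρ√s]` of level `k+1` yields `RegularBlock Cg Λ` (take
`R := 2ρ√s`; smooth from `t₁ − 2s` at radius `r = ϑ√s/2`, `S r² = 2s` reaches `t₁`; uloc at radius `r` from I1 since
`2s ≤ r² ≤ t₁` for `a ≥ a₂`).  [BarkerPrange2020 Thm 1 = tree `BarkerPrange2020_thm1_slab_bounds` (PROVED);
KangMiuraTsai2021 Thm 1.1; `NSBoundedHigherRegularityBounds_holds` (PROVED); I1 `ThinCascade.stub_uniformScaledEnergy`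
(PROVED); BP21 Prop. 19 p.32 for the shape]  Size L (rescaling/translation, classical ⇒ local-energy solution,
pressure normalisation by I1(c), `j = 2` bootstrap). -/
def LightSliceRegular : Prop :=
  ∀ M : ℝ, 1 ≤ M → ∃ Cg γ ϑ a₂ : ℝ, 1 ≤ Cg ∧ 0 < γ ∧ 1 ≤ ϑ ∧ 0 < a₂ ∧
    ∀ Λ a : ℝ, 1 ≤ Λ → a₂ ≤ a →
      ∀ (T τ t₁ : ℝ) (x₀ : EuclideanSpace ℝ (Fin 3))
        (u : ℝ → EuclideanSpace ℝ (Fin 3) → EuclideanSpace ℝ (Fin 3)) (p : ℝ → EuclideanSpace ℝ (Fin 3) → ℝ)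
        (k : ℕ) (ρ : ℝ),
        (IsClassicalNSSolutionOn (Icc 0 T) 1 0 u p ∧
          ∀ m : ℕ, ∃ C : NNReal, ∀ t ∈ Icc 0 T, eLpNorm (iteratedFDeriv ℝ m (u t)) 2 volume ≤ C) →
        0 < τ →
        (∀ t ∈ Icc 0 T, ∀ x : EuclideanSpace ℝ (Fin 3), ‖u t x‖ ≤ M * (T + τ - t) ^ (-(1 / 2 : ℝ))) →
        t₁ ∈ Ioc 0 T → 4 * M ≤ ρ → ϑ ≤ ρ → 4 * Λ * ρ ≤ Real.exp a →
        LightBlock γ ϑ (4 * Λ) a u t₁ x₀ (k + 1) ρ → RegularBlock Cg Λ M a u t₁ x₀ (k + 1)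

/-! ### The kernel's per-level deposit Prop -/

/-- **`GoodDepositAt`**: the per-level deposit property at fixed constants — every good level `k+1 ≤ n` under a
violator of size `e^{a(n+1)}` holds `≥ c` of cube mass at `t₁` in its shell. -/
def GoodDepositAt (M μ a c : ℝ) : Prop :=
  ∀ (T τ t₁ : ℝ) (x₀ : EuclideanSpace ℝ (Fin 3))
    (u : ℝ → EuclideanSpace ℝ (Fin 3) → EuclideanSpace ℝ (Fin 3)) (p : ℝ → EuclideanSpace ℝ (Fin 3) → ℝ) (n : ℕ),
    (IsClassicalNSSolutionOn (Icc 0 T) 1 0 u p ∧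
      ∀ m : ℕ, ∃ C : NNReal, ∀ t ∈ Icc 0 T, eLpNorm (iteratedFDeriv ℝ m (u t)) 2 volume ≤ C) →
    0 < τ →
    (∀ t ∈ Icc 0 T, ∀ x : EuclideanSpace ℝ (Fin 3), ‖u t x‖ ≤ M * (T + τ - t) ^ (-(1 / 2 : ℝ))) →
    t₁ ∈ Ioc 0 T → Real.exp (a * (n + 1)) ≤ ‖u t₁ x₀‖ * Real.sqrt t₁ →
    ∀ k : ℕ, k < n → GoodLevel M μ a u t₁ x₀ (k + 1) →
      ENNReal.ofReal c ≤ ∫⁻ x in levelShell M a t₁ x₀ (k + 1), ‖u t₁ x‖ₑ ^ (3 : ℝ)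

end Summit.NavierStokesRegularity.NavierStokesRegularity.Cruxes.TypeIQuantSubcubicExp.FlatChain

end
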